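import Literature.MathematicalPhysics.QuantumFieldTheory.Dimock2011to13.DisconnectedPolymerSums
import Literature.MathematicalPhysics.QuantumFieldTheory.Balaban1983to89.TreeLength

/-!
# Dimock, *The renormalization group according to Balaban* II, App. E on the cell's CONTINUUM carrier: Lemma E.1
(1)–(2) for polygonal Steiner graphs (`ℓ′(Y) ≤ 2ℓ̃(Y) + (|Y| − 1)`, `ℓ̃` = the cell's `steinerLen`) and Lemma E.2 for
the STEINER length — `Σ_{Y ∋ □₀} exp(−a ℓ̃(Y)) ≤ b` over arbitrary finite collections of unit cubes, `a, b`
explicit in `d` — PROVED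

**Citation header (reproduction of PUBLISHED work; template of the Balaban lattice Yang–Mills cell).**
J. Dimock, *The renormalization group according to Balaban. II. Large fields*, J. Math. Phys. **54** (2013) 092301
(= arXiv:1212.5562v2) [Dimock2013BalabanII]: Appendix E `\section{disconnected polymer sums}` — the lengths
`ℓ′, ℓ, ℓ̃` (TeX L6779–6788), Lemma E.1 `\label{steamy}` (L6790–6798; proofs of (1),(2) L6804–6815), Lemma E.2
`\label{kumquat}` (L6833–6845).  TeX line numbers refer to the arXiv source held by the cell
(`inputs/files/dimock/src/1212.5562/1212.5562.tex`, sha256[:16] 75c5792fc48eacbc).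

**What the paper prints (verbatim).**  L6781–6788: *"1. M ℓ′_M(Y) is the length of a minimal tree whose vertices are
the centers of the blocks in Y. 2. M ℓ_M(Y) is the length of a minimal tree whose vertices are one point from each
block in Y. 3. M ℓ̃_M(Y) is the length of a minimal tree whose vertices are one point from each block in Y and
possibly other points. We have trivially ℓ̃_M(Y) ≤ ℓ_M(Y) ≤ ℓ′_M(Y)."*  Lemma E.1 (L6792–6795): *"1. ℓ_M(Y) ≤ 2ℓ̃_M(Y)
2. ℓ′_M(Y) ≤ ℓ_M(Y) + |Y|_M 3. |Y|_M ≤ 4(2^d+1)(ℓ_M(Y)+1)"*; proof of (1) L6804–6807: *"[DIS73]. Let τ̃ be a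
minimal tree of length ℓ(τ̃) = ℓ̃(Y). One can traverse τ̃ with a path γ̃ which passes through every vertex and has
length 2ℓ̃_M(Y). … Hence ℓ(Y) ≤ ℓ(γ) ≤ ℓ(γ̃) = 2ℓ̃(Y)"*; proof of (2) L6808–6815: *"Replace each line by a line from
center to center … This increases the lengths by at most one. (We use the metric |x−y| = sup_μ|x_μ − y_μ|)."*  Lemma
E.2 (L6835–6844): *"1. There are constants a′, b′ = 𝒪(1) such that for any M-cube □₀ Σ_{Y : Y ⊃ □₀} exp(−a′ℓ′_M(Y))
≤ b′ 2. There are constants a, b = 𝒪(1) such that Σ_{Y : Y ⊃ □₀} exp(−aℓ_M(Y)) ≤ b"*.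

**What is reproduced here (kernel-checked, zero `sorry`).**  The sibling `DisconnectedPolymerSums` proves E.2 (1)
for the centre length `ℓ′` on `ℤ^d` (`kumquat_one`), E.1 (1)–(2) in GRAPH form (`treeLen'_le_two_mul_wt`,
`treeLen'_le_treeLen'_add`) and E.2 (2) from (1) as arithmetic.  This leaf supplies the CONTINUUM instance on the
cell's carrier — the polygonal graphs of unit `Balaban1983to89.TreeLength` (pv22: `carrier`, `len`, `SAdmissible`,
`steinerLen` = `ℓ̃`, sup metric) — and closes App. E for the Steiner length:
* Part 1 — a CHAIN along a parametrised line: marks `M` with `φ s(p,q) ≤ |τ p − τ q|·D` carry a connecting edge set of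
  weight `≤ (max τ − min τ)·D` (`exists_chain_of_param`; for a segment `[a,b]` with the `lineMap` parameter:
  `exists_chain_on_segment`, weight `≤ dist a b`).
* Part 2 — the PULL-BACK of a connecting edge set along a map of blocks to points with a section (the step "one
  point per block → the block"): `treeLen'_pullback_le` — `ℓ′_{φ}(Y) ≤ ℓ′_d(w(Y)) + c(#Y − 1)` whenever `φ s(y,y′) ≤
  d(w y, w y′) + c` (`c = 1`: *"This increases the lengths by at most one"*); and the homogeneity `treeLen'_smul`.
* Part 3 — SUBDIVISION of a polygonal graph: if `carrier T` is preconnected, every finite set of marked points on it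
  lies in a finite vertex set `V ⊂ carrier T` with a connecting edge set `E` of total sup-length `wt E ≤ len T`
  (`exists_subdivision`): per segment the chain of Part 1 through its endpoints, its marks and one shared point per
  meeting segment; connectedness of the segment-intersection graph from `isPreconnected_closed_iff`
  (`segments_reflTransGen`); `sum_toFinset_dist_le_len`.
* Part 4 — **LEMMA E.1 (1)–(2) ON THE CARRIER**: for `Y ≠ ∅` and every Steiner-admissible `T` (connected polygonal
  graph meeting every cube of `Y`), `ℓ′(Y) ≤ 2·len T + (#Y − 1)` (`treeLen'_le_two_mul_len_add`), hence
  **`treeLen'_le_two_mul_steinerLen_add`**: `ℓ′(Y) ≤ 2ℓ̃(Y) + (#Y − 1)` — E.1 (1)+(2) with `ℓ̃` in place of `ℓ`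
  (stronger, since `ℓ̃ ≤ ℓ`), the print's `+|Y|` a fortiori.  Here `ℓ′ = treeLen' (phiZ 1)` of the sibling (centre sup
  distance, `= supDist`).
* Part 5 — **LEMMA E.2 FOR THE STEINER LENGTH** (`kumquat_steiner`): with E.1 (3) in pv22's form `#Y ≤ 2^d(4ℓ̃(Y) +
  1)` (`TreeLength.card_le_steinerLen`), `ℓ̃(Y) ≥ (ℓ′(Y) − (2^d − 1))/(2 + 2^{d+2})`, so for `3^d exp(−a/(2 + 2^{d+2}))
  ≤ 1/8`: `Σ_{Y∈𝒴} exp(−a·ℓ̃(Y)) ≤ 2·exp(a(2^d − 1)/(2 + 2^{d+2}))` for every centre `x₀` and every finite family `𝒴`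
  of finite `Y ∋ x₀` — E.2 (2) for `ℓ̃ ≤ ℓ` (hence for `ℓ` and `ℓ′` too), constants explicit.

**DEVIATIONS (declared).**  As in the sibling: generations instead of Cayley's formula / the Euler tour; the cell's
polygonal graphs (connected finite unions of segments, pv22's convention D-pv22.1) in place of continuum trees — every
tree is such a graph and the infimum `steinerLen` is over the larger class, so `ℓ̃_cell ≤ ℓ̃_print` and Part 5 is at
least as strong as the printed E.2 (2); E.1 (3) enters in pv22's proved form (constant `2^d·4`, additive `2^d`).

**What is NOT claimed.**  Nothing about Dimock's `ℓ` separately (it sits between `ℓ̃` and `ℓ′`); nothing of Bałaban's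
papers (the Bałaban-side sums of TEMPLATE §15.1 G5 are over CONNECTED domains and kernel on the cell's carriers);
no optimisation of constants.  Dimock's papers are the cell's TEMPLATE, published and refereed.  Value = App. E is
kernel on the cell's continuum carrier (TEMPLATE §15.2: the last un-formalised entry of §15's left column); NOT
summit progress.

Cell records: TEMPLATE.md §15.1 G1/G5, §15.2; GAPS C-tmpl27-3; unit `b2b-balaban-template` gen 27.  NEW leaf;
imports `Dimock2011to13.DisconnectedPolymerSums` and `Balaban1983to89.TreeLength`; modifies nothing.
-/

noncomputable section

open Finset Real
open scoped Classical
open Literature.MathematicalPhysics.QuantumFieldTheory.Balaban1983to89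
open Literature.MathematicalPhysics.QuantumFieldTheory.Balaban1983to89.B13ScaleTransfer
open Literature.MathematicalPhysics.QuantumFieldTheory.Balaban1983to89.TreeLength
open Literature.MathematicalPhysics.QuantumFieldTheory.Dimock2011to13.DisconnectedPolymerSums

namespace Literature.MathematicalPhysics.QuantumFieldTheory.Dimock2011to13.SteinerLengthSums

/-! ## Part 1. A chain along a parametrised line -/

section Chain

variable {P : Type*}

/-- `IsConnOn {p} ∅`: a single vertex needs no edge. [folklore] -/
theorem isConnOn_singleton_empty (p : P) : IsConnOn ({p} : Finset P) (∅ : Finset (Sym2 P)) := by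
  refine ⟨Finset.empty_subset _, fun e he => absurd he (Finset.notMem_empty e), fun x hx y hy => ?_⟩
  rw [Finset.mem_singleton] at hx hy
  subst hx; subst hy
  exact Relation.ReflTransGen.refl

/-- **CHAIN LEMMA**: if the marks `M ≠ ∅` carry a parameter `τ` with `φ s(p,q) ≤ |τ p − τ q|·D` (`D ≥ 0`), then some
edge set connects `M` with weight `≤ (max_M τ − min_M τ)·D` (join the mark of largest parameter to the next one and
recurse). [folklore] -/
theorem exists_chain_of_param (φ : Sym2 P → ℝ) (τ : P → ℝ) {D : ℝ} (hD : 0 ≤ D) (M : Finset P) :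
    ∀ hM : M.Nonempty, (∀ p ∈ M, ∀ q ∈ M, φ s(p, q) ≤ |τ p - τ q| * D) →
      ∃ E, IsConnOn M E ∧ wt φ E ≤ (M.sup' hM τ - M.inf' hM τ) * D := by
  induction M using Finset.strongInduction with
  | H M ih =>
    intro hM hφ
    obtain ⟨pm, hpm, hmax⟩ := Finset.exists_max_image M τ hM
    by_cases hsing : M.erase pm = ∅
    · -- a single mark
      have hM1 : M = {pm} := by
        ext x; constructor
        · intro hx; rw [Finset.mem_singleton]; by_contra hne
          have : x ∈ M.erase pm := Finset.mem_erase.2 ⟨hne, hx⟩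
          rw [hsing] at this; exact absurd this (Finset.notMem_empty x)
        · intro hx; rw [Finset.mem_singleton] at hx; subst hx; exact hpm
      subst hM1
      refine ⟨∅, isConnOn_singleton_empty pm, ?_⟩
      simp [wt]
    · have hM' : (M.erase pm).Nonempty := Finset.nonempty_iff_ne_empty.2 hsing
      obtain ⟨p₂, hp₂, hmax₂⟩ := Finset.exists_max_image (M.erase pm) τ hM'
      have hp₂M : p₂ ∈ M := Finset.mem_of_mem_erase hp₂
      have hne : pm ≠ p₂ := fun h => (Finset.mem_erase.1 hp₂).1 h.symm
      obtain ⟨E', hE', hwt'⟩ := ih (M.erase pm) (Finset.erase_ssubset hpm) hM'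
        (fun p hp q hq => hφ p (Finset.mem_of_mem_erase hp) q (Finset.mem_of_mem_erase hq))
      refine ⟨insert s(pm, p₂) E', ?_, ?_⟩
      · refine isConnOn_of_reaches p₂ (fun e he => ?_) (fun e he => ?_) (fun y hy => ?_)
        · rw [Finset.mem_insert] at he
          rcases he with rfl | he
          · exact Finset.mk_mem_sym2_iff.2 ⟨hpm, hp₂M⟩
          · exact Finset.sym2_mono (Finset.erase_subset _ _) (hE'.1 he)
        · rw [Finset.mem_insert] at he
          rcases he with rfl | he
          · rw [Sym2.mk_isDiag_iff]; exact hne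
          · exact hE'.2.1 e he
        · by_cases hyp : y = pm
          · subst hyp
            exact Relation.ReflTransGen.single (Finset.mem_insert_self _ _)
          · exact rtg_mono (Finset.subset_insert _ _) (hE'.2.2 y (Finset.mem_erase.2 ⟨hyp, hy⟩) p₂ hp₂)
      · -- weight bookkeeping
        have h2m : τ p₂ ≤ τ pm := hmax p₂ hp₂M
        have hφe : φ s(pm, p₂) ≤ (τ pm - τ p₂) * D := by
          have h := hφ pm hpm p₂ hp₂M
          rwa [abs_of_nonneg (by linarith)] at h
        have hsup' : (M.erase pm).sup' hM' τ ≤ τ p₂ := Finset.sup'_le _ _ fun q hq => hmax₂ q hq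
        have hinf' : M.inf' hM τ ≤ (M.erase pm).inf' hM' τ :=
          Finset.le_inf' _ _ fun q hq => Finset.inf'_le _ (Finset.mem_of_mem_erase hq)
        have hsup : τ pm ≤ M.sup' hM τ := Finset.le_sup' _ hpm
        have hmono : ((M.erase pm).sup' hM' τ - (M.erase pm).inf' hM' τ) * D ≤
            (M.sup' hM τ - M.inf' hM τ) * D :=
          mul_le_mul_of_nonneg_right (by linarith) hD
        by_cases h : s(pm, p₂) ∈ E'
        · rw [Finset.insert_eq_of_mem h]; exact hwt'.trans hmono
        · have hwt : wt φ (insert s(pm, p₂) E') = φ s(pm, p₂) + wt φ E' := by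
            unfold wt; rw [Finset.sum_insert h]
          rw [hwt]
          calc φ s(pm, p₂) + wt φ E'
              ≤ (τ pm - τ p₂) * D + ((M.erase pm).sup' hM' τ - (M.erase pm).inf' hM' τ) * D :=
                add_le_add hφe hwt'
            _ = ((τ pm - τ p₂) + ((M.erase pm).sup' hM' τ - (M.erase pm).inf' hM' τ)) * D := by ring
            _ ≤ (M.sup' hM τ - M.inf' hM τ) * D := mul_le_mul_of_nonneg_right (by linarith) hD

/-- On a segment `[a,b]` of a real normed space every finite set of points containing a point carries a connecting
edge set of total length `≤ dist a b` (parameter = the `lineMap` coordinate; `dist (lineMap a b t) (lineMap a b t′) =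
|t − t′|·dist a b`). [folklore] -/
theorem exists_chain_on_segment {V : Type*} [NormedAddCommGroup V] [NormedSpace ℝ V] (a b : V) (M : Finset V)
    (hM : M.Nonempty) (hsub : ∀ p ∈ M, p ∈ segment ℝ a b) :
    ∃ E, IsConnOn M E ∧ wt (symW (fun p q : V => dist p q) dist_comm) E ≤ dist a b := by
  have hpar : ∀ p ∈ M, ∃ t : ℝ, t ∈ Set.Icc (0 : ℝ) 1 ∧ AffineMap.lineMap a b t = p := by
    intro p hp
    have h := hsub p hp
    rw [segment_eq_image_lineMap] at h
    obtain ⟨t, ht, htp⟩ := h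
    exact ⟨t, ht, htp⟩
  choose! τ hτI hτp using hpar
  have hφ : ∀ p ∈ M, ∀ q ∈ M, symW (fun p q : V => dist p q) dist_comm s(p, q) ≤ |τ p - τ q| * dist a b := by
    intro p hp q hq
    have e1 : dist p q = dist (AffineMap.lineMap a b (τ p)) (AffineMap.lineMap a b (τ q)) := by
      rw [hτp p hp, hτp q hq]
    rw [symW_mk, e1, dist_lineMap_lineMap, Real.dist_eq]
  obtain ⟨E, hE, hwt⟩ := exists_chain_of_param _ τ dist_nonneg M hM hφ
  refine ⟨E, hE, hwt.trans ?_⟩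
  have hs : M.sup' hM τ ≤ 1 := Finset.sup'_le _ _ fun q hq => (hτI q hq).2
  have hi : 0 ≤ M.inf' hM τ := Finset.le_inf' _ _ fun q hq => (hτI q hq).1
  calc (M.sup' hM τ - M.inf' hM τ) * dist a b ≤ 1 * dist a b :=
        mul_le_mul_of_nonneg_right (by linarith) dist_nonneg
    _ = dist a b := one_mul _

end Chain

/-! ## Part 2. Pull-back along "one point per block", and homogeneity -/

section Pullback

variable {Q P : Type*}

/-- Sums of terms non-negative on the source, over an image, are at most the source sum. [folklore] -/
theorem sum_image_le_sum_of_nonneg_on {ι α : Type*} [DecidableEq α] (s : Finset ι) (g : ι → α) (f : α → ℝ)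
    (hf : ∀ i ∈ s, 0 ≤ f (g i)) : ∑ a ∈ s.image g, f a ≤ ∑ i ∈ s, f (g i) := by
  rw [← Finset.sum_fiberwise_of_maps_to (s := s) (t := s.image g) (g := g)
    (fun i hi => Finset.mem_image_of_mem g hi) (fun i => f (g i))]
  refine Finset.sum_le_sum fun a ha => ?_
  obtain ⟨i, hi, rfl⟩ := Finset.mem_image.1 ha
  have hmem : i ∈ s.filter (fun j => g j = g i) := Finset.mem_filter.2 ⟨hi, rfl⟩
  calc f (g i) ≤ ∑ j ∈ s.filter (fun j => g j = g i), f (g i) :=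
        Finset.single_le_sum (f := fun _ => f (g i)) (fun _ _ => hf i hi) hmem
    _ = ∑ j ∈ s.filter (fun j => g j = g i), f (g j) :=
        Finset.sum_congr rfl fun j hj => by rw [(Finset.mem_filter.1 hj).2]

/-- Sums of terms non-negative on `A ∪ B` over the union are at most the sum of the two sums. [folklore] -/
theorem sum_union_le_of_nonneg_on {α : Type*} [DecidableEq α] (A B : Finset α) (f : α → ℝ)
    (hf : ∀ x ∈ A ∪ B, 0 ≤ f x) : ∑ x ∈ A ∪ B, f x ≤ ∑ x ∈ A, f x + ∑ x ∈ B, f x := by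
  rw [← Finset.sum_union_inter]
  have : 0 ≤ ∑ x ∈ A ∩ B, f x :=
    Finset.sum_nonneg fun x hx => hf x (Finset.mem_union_left _ (Finset.mem_of_mem_inter_left hx))
  linarith

/-- **PULL-BACK** — the step *"one point from each block"* → *"the block"*: for blocks `Y ≠ ∅`, a point assignment
`w`, a pseudo-metric `d` on points (`d ≥ 0`, `d(x,x) = 0`) and a block weight with `φ ≥ 0` and `φ s(y,y′) ≤
d(w y, w y′) + c` for `y ≠ y′` in `Y` (`c ≥ 0`; `c = 1` for centres vs. points of unit cubes in the sup metric), `ℓ′_φ(Y) ≤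
ℓ′_d(w(Y)) + c(#Y − 1)`: a minimal connecting set of the point set `w(Y)`, pruned to `#w(Y) − 1` edges, is lifted
along a section of `w`, and the `#Y − #w(Y)` blocks off the section are joined to their representative at cost `≤ c`
each. [cite: Dimock2013BalabanII, App. E Lemma E.1 (2) (arXiv:1212.5562v2 TeX L6794–6795, proof L6808–6815)] -/
theorem treeLen'_pullback_le [DecidableEq Q] [DecidableEq P] (w : Q → P) {d : P → P → ℝ}
    (hds : ∀ x y, d x y = d y x) (hd0 : ∀ x, d x x = 0)
    (hdn : ∀ x y, 0 ≤ d x y) {φ : Sym2 Q → ℝ} (hφ : ∀ e, ¬e.IsDiag → 0 ≤ φ e) {c : ℝ} (hc : 0 ≤ c)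
    {Y : Finset Q} (hle : ∀ y ∈ Y, ∀ y' ∈ Y, y ≠ y' → φ s(y, y') ≤ d (w y) (w y') + c) (hY : Y.Nonempty) :
    treeLen' φ Y ≤ treeLen' (symW d hds) (Y.image w) + c * ((Y.card : ℝ) - 1) := by
  obtain ⟨y₀, hy₀⟩ := hY
  haveI : Nonempty Q := ⟨y₀⟩
  set R := Y.image w with hR
  have hRne : R.Nonempty := ⟨w y₀, Finset.mem_image_of_mem w hy₀⟩
  set ψ := symW d hds with hψ
  have hψ0 : ∀ e, 0 ≤ ψ e := fun e => by
    induction e using Sym2.ind with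
    | h a b => rw [hψ, symW_mk]; exact hdn a b
  -- a pruned minimal connecting set of the point set
  obtain ⟨F, hFsub, hF, hFcard⟩ :=
    exists_conn_subset_card_le R (minConn ψ R) (minConn_isConnOn ψ R) hRne
  have hFwt : wt ψ F ≤ treeLen' ψ R := by
    rw [← wt_minConn ψ R]
    exact Finset.sum_le_sum_of_subset_of_nonneg hFsub fun e _ _ => hψ0 e
  -- a section of `w` over `R`
  have hsec : ∀ u ∈ R, ∃ y ∈ Y, w y = u := fun u hu => by
    obtain ⟨y, hy, rfl⟩ := Finset.mem_image.1 hu; exact ⟨y, hy, rfl⟩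
  choose! σ hσY hσw using hsec
  have hwR : ∀ y ∈ Y, w y ∈ R := fun y hy => Finset.mem_image_of_mem w hy
  -- the lifted edge set: mapped edges + joins to the representatives, loops removed
  set A := (F.image (Sym2.map σ)).filter (fun e => ¬e.IsDiag) with hA
  set B := (Y.image (fun y => s(y, σ (w y)))).filter (fun e => ¬e.IsDiag) with hB
  set G := A ∪ B with hG
  have hGconn : IsConnOn Y G := by
    refine isConnOn_of_reaches (σ (w y₀)) (fun e he => ?_) (fun e he => ?_) (fun y hy => ?_)
    · rw [hG, Finset.mem_union] at he
      rcases he with he | he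
      · have he' := (Finset.mem_filter.1 he).1
        rw [Finset.mem_image] at he'
        obtain ⟨f, hf, rfl⟩ := he'
        have hfR := hF.1 hf
        induction f using Sym2.ind with
        | h u v =>
          rw [Finset.mk_mem_sym2_iff] at hfR
          rw [Sym2.map_mk]
          exact Finset.mk_mem_sym2_iff.2 ⟨hσY u hfR.1, hσY v hfR.2⟩
      · have he' := (Finset.mem_filter.1 he).1
        rw [Finset.mem_image] at he'
        obtain ⟨y, hy, rfl⟩ := he'
        exact Finset.mk_mem_sym2_iff.2 ⟨hy, hσY _ (hwR y hy)⟩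
    · rw [hG, Finset.mem_union] at he
      rcases he with he | he
      · exact (Finset.mem_filter.1 he).2
      · exact (Finset.mem_filter.1 he).2
    · have step1 : Relation.ReflTransGen (EAdj G) y (σ (w y)) := by
        by_cases h : y = σ (w y)
        · rw [← h]
        · refine Relation.ReflTransGen.single ?_
          unfold EAdj
          rw [hG, Finset.mem_union]
          refine Or.inr ?_
          rw [hB, Finset.mem_filter, Sym2.mk_isDiag_iff]
          exact ⟨Finset.mem_image_of_mem _ hy, h⟩
      have step2 : ∀ u v : P, Relation.ReflTransGen (EAdj F) u v →
          Relation.ReflTransGen (EAdj G) (σ u) (σ v) := by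
        intro u v huv
        induction huv with
        | refl => exact Relation.ReflTransGen.refl
        | @tail b b' _ hbc ih =>
          by_cases hσ : σ b = σ b'
          · rw [← hσ]; exact ih
          · refine ih.tail ?_
            unfold EAdj
            rw [hG, Finset.mem_union]
            refine Or.inl ?_
            rw [hA, Finset.mem_filter, Sym2.mk_isDiag_iff]
            refine ⟨?_, hσ⟩
            rw [Finset.mem_image]
            exact ⟨s(b, b'), hbc, by rw [Sym2.map_mk]⟩
      exact step1.trans (step2 _ _ (hF.2.2 (w y) (hwR y hy) (w y₀) (hwR y₀ hy₀)))
  -- weights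
  have hφA : ∀ e ∈ A, 0 ≤ φ e := fun e he => hφ e (Finset.mem_filter.1 he).2
  have hφB : ∀ e ∈ B, 0 ≤ φ e := fun e he => hφ e (Finset.mem_filter.1 he).2
  have hAeq : A = (F.filter (fun f => ¬(Sym2.map σ f).IsDiag)).image (Sym2.map σ) := by
    rw [hA, Finset.filter_image]
  have hBeq : B = (Y.filter (fun y => y ≠ σ (w y))).image (fun y => s(y, σ (w y))) := by
    rw [hB, Finset.filter_image]
    congr 1
    ext y
    simp only [Finset.mem_filter, Sym2.mk_isDiag_iff]
  have hwtA : ∑ e ∈ A, φ e ≤ wt ψ F + c * F.card := by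
    rw [hAeq]
    have hnn : ∀ f ∈ F.filter (fun f => ¬(Sym2.map σ f).IsDiag), 0 ≤ φ (Sym2.map σ f) :=
      fun f hf => hφ _ (Finset.mem_filter.1 hf).2
    refine (sum_image_le_sum_of_nonneg_on _ _ φ hnn).trans ?_
    calc ∑ f ∈ F.filter (fun f => ¬(Sym2.map σ f).IsDiag), φ (Sym2.map σ f)
        ≤ ∑ f ∈ F.filter (fun f => ¬(Sym2.map σ f).IsDiag), (ψ f + c) := by
          refine Finset.sum_le_sum fun f hf => ?_
          obtain ⟨hfF, hfd⟩ := Finset.mem_filter.1 hf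
          have hfR := hF.1 hfF
          induction f using Sym2.ind with
          | h u v =>
            rw [Finset.mk_mem_sym2_iff] at hfR
            rw [Sym2.map_mk, Sym2.mk_isDiag_iff] at hfd
            rw [Sym2.map_mk, hψ, symW_mk]
            have := hle (σ u) (hσY u hfR.1) (σ v) (hσY v hfR.2) hfd
            rwa [hσw u hfR.1, hσw v hfR.2] at this
      _ ≤ ∑ f ∈ F, (ψ f + c) :=
          Finset.sum_le_sum_of_subset_of_nonneg (Finset.filter_subset _ _) fun f _ _ =>
            add_nonneg (hψ0 f) hc
      _ = wt ψ F + c * F.card := by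
          unfold wt; rw [Finset.sum_add_distrib, Finset.sum_const, nsmul_eq_mul, mul_comm]
  have hwtB : ∑ e ∈ B, φ e ≤ c * ((Y.filter (fun y => y ≠ σ (w y))).card : ℝ) := by
    rw [hBeq]
    have hnn : ∀ y ∈ Y.filter (fun y => y ≠ σ (w y)), 0 ≤ φ s(y, σ (w y)) :=
      fun y hy => hφ _ (by rw [Sym2.mk_isDiag_iff]; exact (Finset.mem_filter.1 hy).2)
    refine (sum_image_le_sum_of_nonneg_on _ _ φ hnn).trans ?_
    calc ∑ y ∈ Y.filter (fun y => y ≠ σ (w y)), φ s(y, σ (w y))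
        ≤ ∑ y ∈ Y.filter (fun y => y ≠ σ (w y)), c := by
          refine Finset.sum_le_sum fun y hy => ?_
          obtain ⟨hyY, hne⟩ := Finset.mem_filter.1 hy
          have := hle y hyY (σ (w y)) (hσY _ (hwR y hyY)) hne
          rwa [hσw (w y) (hwR y hyY), hd0, zero_add] at this
      _ = c * ((Y.filter (fun y => y ≠ σ (w y))).card : ℝ) := by
          rw [Finset.sum_const, nsmul_eq_mul, mul_comm]
  have hwtG : wt φ G ≤ (wt ψ F + c * F.card) + c * ((Y.filter (fun y => y ≠ σ (w y))).card : ℝ) := by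
    unfold wt
    rw [hG]
    refine (sum_union_le_of_nonneg_on A B φ fun e he => ?_).trans (add_le_add hwtA hwtB)
    rcases Finset.mem_union.1 he with he | he
    · exact hφA e he
    · exact hφB e he
  -- counting: #F ≤ #R − 1 and #{y ≠ σ(w y)} = #Y − #R
  have hfix : (Y.filter (fun y => y = σ (w y))).card = R.card := by
    have heq : Y.filter (fun y => y = σ (w y)) = R.image σ := by
      ext y; constructor
      · intro hy
        obtain ⟨hyY, hyeq⟩ := Finset.mem_filter.1 hy
        exact Finset.mem_image.2 ⟨w y, hwR y hyY, hyeq.symm⟩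
      · intro hy
        obtain ⟨u, hu, rfl⟩ := Finset.mem_image.1 hy
        exact Finset.mem_filter.2 ⟨hσY u hu, by rw [hσw u hu]⟩
    rw [heq, Finset.card_image_of_injOn]
    intro u hu v hv huv
    have h1 := hσw u (Finset.mem_coe.1 hu)
    have h2 := hσw v (Finset.mem_coe.1 hv)
    rw [← h1, ← h2, huv]
  have hsplit : (Y.filter (fun y => y = σ (w y))).card + (Y.filter (fun y => ¬(y = σ (w y)))).card = Y.card :=
    Finset.card_filter_add_card_filter_not _
  have hcnt : ((Y.filter (fun y => y ≠ σ (w y))).card : ℝ) = Y.card - R.card := by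
    have h' : ((Y.filter (fun y => y = σ (w y))).card : ℝ) +
        ((Y.filter (fun y => ¬(y = σ (w y)))).card : ℝ) = Y.card := by exact_mod_cast hsplit
    rw [hfix] at h'
    have : (Y.filter (fun y => y ≠ σ (w y))) = (Y.filter (fun y => ¬(y = σ (w y)))) := rfl
    rw [this]; linarith
  have hFc : (F.card : ℝ) ≤ R.card - 1 := by
    have : (F.card : ℝ) + 1 ≤ R.card := by exact_mod_cast hFcard
    linarith
  calc treeLen' φ Y ≤ wt φ G := treeLen'_le_wt hGconn
    _ ≤ (wt ψ F + c * F.card) + c * ((Y.filter (fun y => y ≠ σ (w y))).card : ℝ) := hwtG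
    _ ≤ treeLen' ψ R + c * ((R.card : ℝ) - 1) + c * ((Y.card : ℝ) - R.card) := by
        rw [hcnt]; nlinarith
    _ = treeLen' ψ R + c * ((Y.card : ℝ) - 1) := by ring

/-- HOMOGENEITY: `ℓ′_{tφ} = t·ℓ′_φ` for `t > 0`. [folklore] -/
theorem treeLen'_smul {φ : Sym2 P → ℝ} {t : ℝ} (ht : 0 < t) (Y : Finset P) :
    treeLen' (fun e => t * φ e) Y = t * treeLen' φ Y := by
  have hwt : ∀ E, wt (fun e => t * φ e) E = t * wt φ E := fun E => by
    unfold wt; rw [Finset.mul_sum]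
  apply le_antisymm
  · calc treeLen' (fun e => t * φ e) Y ≤ wt (fun e => t * φ e) (minConn φ Y) :=
          treeLen'_le_wt (minConn_isConnOn φ Y)
      _ = t * treeLen' φ Y := by rw [hwt, wt_minConn]
  · have h := treeLen'_le_wt (φ := φ) (minConn_isConnOn (fun e => t * φ e) Y)
    have h2 : wt φ (minConn (fun e => t * φ e) Y) = t⁻¹ * treeLen' (fun e => t * φ e) Y := by
      rw [← wt_minConn (fun e => t * φ e) Y, hwt, ← mul_assoc, inv_mul_cancel₀ ht.ne', one_mul]
    rw [h2] at h
    calc t * treeLen' φ Y ≤ t * (t⁻¹ * treeLen' (fun e => t * φ e) Y) := mul_le_mul_of_nonneg_left h ht.le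
      _ = treeLen' (fun e => t * φ e) Y := by rw [← mul_assoc, mul_inv_cancel₀ ht.ne', one_mul]

end Pullback

/-! ## Part 3. Subdivision of a polygonal graph (the cell's carrier, sup metric) -/

section Subdivision

variable {d : ℕ}

/-- The point weight: sup-metric distance on `ℝ^d`. [folklore] -/
def δR : Sym2 (RPt d) → ℝ := symW (fun p q : RPt d => dist p q) dist_comm

/-- `δR s(p,q) = dist p q`. [folklore] -/
@[simp] theorem δR_mk (p q : RPt d) : δR s(p, q) = dist p q := rfl

/-- `δR ≥ 0`. [folklore] -/
theorem δR_nonneg (e : Sym2 (RPt d)) : 0 ≤ δR e := by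
  induction e using Sym2.ind with
  | h a b => rw [δR_mk]; exact dist_nonneg

/-- The closed segment of a recorded segment. [folklore] -/
def sgm (s : Seg d) : Set (RPt d) := segment ℝ s.1 s.2

/-- The carrier is the union of the segments of the list (as a finite set of segments). [folklore] -/
theorem mem_carrier_iff_toFinset {T : List (Seg d)} {z : RPt d} :
    z ∈ carrier T ↔ ∃ s ∈ T.toFinset, z ∈ sgm s := by
  rw [mem_carrier]
  simp only [List.mem_toFinset, sgm]

/-- Duplicated segments only help: `Σ_{s ∈ T.toFinset} dist s.1 s.2 ≤ len T`. [folklore] -/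
theorem sum_toFinset_dist_le_len (T : List (Seg d)) : ∑ s ∈ T.toFinset, dist s.1 s.2 ≤ len T := by
  induction T with
  | nil => simp
  | cons s T ih =>
    rw [List.toFinset_cons, len_cons]
    by_cases h : s ∈ T.toFinset
    · rw [Finset.insert_eq_of_mem h]; linarith [dist_nonneg (x := s.1) (y := s.2)]
    · rw [Finset.sum_insert h]; linarith

/-- Two segments MEET. [folklore] -/
def Meets (s s' : Seg d) : Prop := (sgm s ∩ sgm s').Nonempty

/-- `Meets` is symmetric. [folklore] -/
theorem Meets.symm {s s' : Seg d} (h : Meets s s') : Meets s' s := by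
  obtain ⟨z, h1, h2⟩ := h; exact ⟨z, h2, h1⟩

/-- Meeting INSIDE a given family of segments. [folklore] -/
def MeetsIn (SG : Finset (Seg d)) (s s' : Seg d) : Prop := s ∈ SG ∧ s' ∈ SG ∧ Meets s s'

/-- CONNECTEDNESS OF THE SEGMENT-INTERSECTION GRAPH: if the carrier is preconnected, any two segments of the list are
joined by a chain of pairwise meeting segments of the list (otherwise the two classes give a separation of the
carrier by two disjoint closed sets). [folklore] -/
theorem segments_reflTransGen {T : List (Seg d)} (hT : IsPreconnected (carrier T)) {s s' : Seg d}
    (hs : s ∈ T.toFinset) (hs' : s' ∈ T.toFinset) : Relation.ReflTransGen (MeetsIn T.toFinset) s s' := by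
  by_contra hnot
  set A := T.toFinset.filter (fun u => Relation.ReflTransGen (MeetsIn T.toFinset) s u) with hA
  set B := T.toFinset.filter (fun u => ¬Relation.ReflTransGen (MeetsIn T.toFinset) s u) with hB
  set FA : Set (RPt d) := ⋃ u ∈ (A : Set (Seg d)), sgm u with hFA
  set FB : Set (RPt d) := ⋃ u ∈ (B : Set (Seg d)), sgm u with hFB
  have hcA : IsClosed FA := (A.finite_toSet).isClosed_biUnion fun u _ => isClosed_segment' u
  have hcB : IsClosed FB := (B.finite_toSet).isClosed_biUnion fun u _ => isClosed_segment' u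
  have hcover : carrier T ⊆ FA ∪ FB := by
    intro z hz
    obtain ⟨u, hu, hzu⟩ := mem_carrier_iff_toFinset.1 hz
    by_cases h : Relation.ReflTransGen (MeetsIn T.toFinset) s u
    · exact Or.inl (Set.mem_iUnion₂.2 ⟨u, Finset.mem_coe.2 (Finset.mem_filter.2 ⟨hu, h⟩), hzu⟩)
    · exact Or.inr (Set.mem_iUnion₂.2 ⟨u, Finset.mem_coe.2 (Finset.mem_filter.2 ⟨hu, h⟩), hzu⟩)
  have hsA : s ∈ A := Finset.mem_filter.2 ⟨hs, Relation.ReflTransGen.refl⟩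
  have hs'B : s' ∈ B := Finset.mem_filter.2 ⟨hs', hnot⟩
  have hneA : (carrier T ∩ FA).Nonempty :=
    ⟨s.1, mem_carrier_iff_toFinset.2 ⟨s, hs, left_mem_segment ℝ _ _⟩,
      Set.mem_iUnion₂.2 ⟨s, Finset.mem_coe.2 hsA, left_mem_segment ℝ _ _⟩⟩
  have hneB : (carrier T ∩ FB).Nonempty :=
    ⟨s'.1, mem_carrier_iff_toFinset.2 ⟨s', hs', left_mem_segment ℝ _ _⟩,
      Set.mem_iUnion₂.2 ⟨s', Finset.mem_coe.2 hs'B, left_mem_segment ℝ _ _⟩⟩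
  obtain ⟨z, _, hzA, hzB⟩ := isPreconnected_closed_iff.1 hT FA FB hcA hcB hcover hneA hneB
  rw [hFA, Set.mem_iUnion₂] at hzA
  rw [hFB, Set.mem_iUnion₂] at hzB
  obtain ⟨u, hu, hzu⟩ := hzA
  obtain ⟨v, hv, hzv⟩ := hzB
  have hu' := Finset.mem_filter.1 (Finset.mem_coe.1 hu)
  have hv' := Finset.mem_filter.1 (Finset.mem_coe.1 hv)
  exact hv'.2 (hu'.2.tail ⟨hu'.1, hv'.1, ⟨z, hzu, hzv⟩⟩)

/-- A chosen common point of two meeting segments (junk otherwise). [folklore] -/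
def rep (s s' : Seg d) : RPt d := if h : Meets s s' then h.some else s.1

/-- The chosen common point lies on both segments. [folklore] -/
theorem rep_mem {s s' : Seg d} (h : Meets s s') : rep s s' ∈ sgm s ∧ rep s s' ∈ sgm s' := by
  unfold rep; rw [dif_pos h]; exact h.some_mem

/-- The marks of a segment: its first endpoint, the given marks lying on it, and the shared points with every meeting
segment of the family (both `rep s s′` and `rep s′ s`, so that meeting segments have a COMMON vertex). [folklore] -/
def marks (SG : Finset (Seg d)) (S : Finset (RPt d)) (s : Seg d) : Finset (RPt d) :=
  insert s.1 (S.filter (fun p => p ∈ sgm s) ∪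
    ((SG.filter (Meets s)).image (rep s) ∪ (SG.filter (Meets s)).image (fun s' => rep s' s)))

/-- Marks lie on their segment. [folklore] -/
theorem marks_subset_sgm (SG : Finset (Seg d)) (S : Finset (RPt d)) (s : Seg d) :
    ∀ p ∈ marks SG S s, p ∈ sgm s := by
  intro p hp
  unfold marks at hp
  rw [Finset.mem_insert] at hp
  rcases hp with rfl | hp
  · exact left_mem_segment ℝ _ _
  · rcases Finset.mem_union.1 hp with hp | hp
    · exact (Finset.mem_filter.1 hp).2
    · rcases Finset.mem_union.1 hp with hp | hp
      · obtain ⟨s', hs', rfl⟩ := Finset.mem_image.1 hp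
        exact (rep_mem (Finset.mem_filter.1 hs').2).1
      · obtain ⟨s', hs', rfl⟩ := Finset.mem_image.1 hp
        exact (rep_mem (Finset.mem_filter.1 hs').2.symm).2

/-- The first endpoint is a mark. [folklore] -/
theorem fst_mem_marks (SG : Finset (Seg d)) (S : Finset (RPt d)) (s : Seg d) : s.1 ∈ marks SG S s :=
  Finset.mem_insert_self _ _

/-- A given mark on the segment is a mark of the segment. [folklore] -/
theorem mark_mem_marks {SG : Finset (Seg d)} {S : Finset (RPt d)} {s : Seg d} {p : RPt d} (hp : p ∈ S)
    (hps : p ∈ sgm s) : p ∈ marks SG S s :=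
  Finset.mem_insert_of_mem (Finset.mem_union_left _ (Finset.mem_filter.2 ⟨hp, hps⟩))

/-- The shared point `rep s s′` is a mark of `s`. [folklore] -/
theorem rep_mem_marks_left {SG : Finset (Seg d)} {S : Finset (RPt d)} {s s' : Seg d} (hs' : s' ∈ SG)
    (hm : Meets s s') : rep s s' ∈ marks SG S s :=
  Finset.mem_insert_of_mem (Finset.mem_union_right _ (Finset.mem_union_left _
    (Finset.mem_image.2 ⟨s', Finset.mem_filter.2 ⟨hs', hm⟩, rfl⟩)))

/-- The shared point `rep s s′` is a mark of `s′`. [folklore] -/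
theorem rep_mem_marks_right {SG : Finset (Seg d)} {S : Finset (RPt d)} {s s' : Seg d} (hs : s ∈ SG)
    (hm : Meets s s') : rep s s' ∈ marks SG S s' :=
  Finset.mem_insert_of_mem (Finset.mem_union_right _ (Finset.mem_union_right _
    (Finset.mem_image.2 ⟨s, Finset.mem_filter.2 ⟨hs, hm.symm⟩, rfl⟩)))

/-- **SUBDIVISION** — a polygonal graph with preconnected carrier and a finite set `S` of marked points on it has a
finite vertex set `V ⊇ S` on the carrier and a connecting edge set `E` on `V` of total sup-length `wt E ≤ len T`:
the union over the segments of the chains of Part 1 through their marks. [folklore] -/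
theorem exists_subdivision {T : List (Seg d)} (hT : IsPreconnected (carrier T)) (hne : T ≠ [])
    {S : Finset (RPt d)} (hS : ∀ p ∈ S, p ∈ carrier T) :
    ∃ V : Finset (RPt d), S ⊆ V ∧ (∀ v ∈ V, v ∈ carrier T) ∧ ∃ E, IsConnOn V E ∧ wt δR E ≤ len T := by
  set SG := T.toFinset with hSG
  have hSGne : SG.Nonempty := by
    obtain ⟨s, hs⟩ := List.exists_mem_of_ne_nil T hne
    exact ⟨s, List.mem_toFinset.2 hs⟩
  have hchain : ∀ s ∈ SG, ∃ E, IsConnOn (marks SG S s) E ∧ wt δR E ≤ dist s.1 s.2 := fun s _ =>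
    exists_chain_on_segment s.1 s.2 (marks SG S s) ⟨s.1, fst_mem_marks SG S s⟩ (marks_subset_sgm SG S s)
  choose! Es hEs hEswt using hchain
  set V := SG.biUnion (marks SG S) with hV
  set E := SG.biUnion Es with hE
  refine ⟨V, fun p hp => ?_, fun v hv => ?_, E, ?_, ?_⟩
  · obtain ⟨s, hs, hps⟩ := mem_carrier_iff_toFinset.1 (hS p hp)
    exact Finset.mem_biUnion.2 ⟨s, hs, mark_mem_marks hp hps⟩
  · obtain ⟨s, hs, hv⟩ := Finset.mem_biUnion.1 hv
    exact mem_carrier_iff_toFinset.2 ⟨s, hs, marks_subset_sgm SG S s v hv⟩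
  · obtain ⟨s₀, hs₀⟩ := hSGne
    have hreach_in : ∀ s ∈ SG, ∀ p ∈ marks SG S s, ∀ q ∈ marks SG S s, Relation.ReflTransGen (EAdj E) p q :=
      fun s hs p hp q hq => rtg_mono (Finset.subset_biUnion_of_mem Es hs) ((hEs s hs).2.2 p hp q hq)
    -- along a chain of meeting segments of the family, first endpoints are joined
    have hseg : ∀ s s' : Seg d, Relation.ReflTransGen (MeetsIn SG) s s' → s ∈ SG →
        Relation.ReflTransGen (EAdj E) s.1 s'.1 := by
      intro s s' h hs
      induction h with
      | refl => exact Relation.ReflTransGen.refl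
      | @tail u v _ huv ih =>
        obtain ⟨hu, hv, hm⟩ := huv
        exact (ih.trans (hreach_in u hu u.1 (fst_mem_marks SG S u) (rep u v) (rep_mem_marks_left hv hm))).trans
          (hreach_in v hv (rep u v) (rep_mem_marks_right hu hm) v.1 (fst_mem_marks SG S v))
    refine isConnOn_of_reaches s₀.1 (fun e he => ?_) (fun e he => ?_) (fun v hv => ?_)
    · obtain ⟨s, hs, he⟩ := Finset.mem_biUnion.1 he
      exact Finset.sym2_mono (Finset.subset_biUnion_of_mem (marks SG S) hs) ((hEs s hs).1 he)
    · obtain ⟨s, hs, he⟩ := Finset.mem_biUnion.1 he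
      exact (hEs s hs).2.1 e he
    · obtain ⟨s, hs, hv⟩ := Finset.mem_biUnion.1 hv
      exact (hreach_in s hs v hv s.1 (fst_mem_marks SG S s)).trans
        (hseg s s₀ (segments_reflTransGen hT hs hs₀) hs)
  · calc wt δR E ≤ ∑ s ∈ SG, wt δR (Es s) := by
          unfold wt; exact sum_biUnion_le_of_nonneg SG Es δR δR_nonneg
      _ ≤ ∑ s ∈ SG, dist s.1 s.2 := Finset.sum_le_sum fun s hs => hEswt s hs
      _ ≤ len T := sum_toFinset_dist_le_len T

end Subdivision

/-! ## Part 4. Lemma E.1 (1)–(2) on the cell's carrier: `ℓ′(Y) ≤ 2·len T + (#Y − 1) ≤ 2ℓ̃(Y) + (#Y − 1)` -/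

section Carrier

variable {d : ℕ}

/-- A real bound on every coordinate difference bounds the (ℕ-valued) sup distance of two cube indices. [folklore] -/
theorem natCast_supDist_le {x y : Pt d} {C : ℝ} (hC : 0 ≤ C) (h : ∀ i, |((x i : ℝ)) - (y i : ℝ)| ≤ C) :
    (supDist x y : ℝ) ≤ C := by
  have h1 : supDist x y ≤ ⌊C⌋₊ := by
    rw [supDist_le_iff]
    intro i
    refine Nat.le_floor ?_
    have : ((x i - y i).natAbs : ℝ) = |((x i : ℝ)) - (y i : ℝ)| := by
      rw [Nat.cast_natAbs, Int.cast_abs, Int.cast_sub]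
    rw [this]; exact h i
  calc (supDist x y : ℝ) ≤ (⌊C⌋₊ : ℝ) := by exact_mod_cast h1
    _ ≤ C := Nat.floor_le hC

/-- *"This increases the lengths by at most one"* (L6810–6811) in the sup metric: for points `p ∈ □_x`, `q ∈ □_y` of
unit cubes, the sup distance of the cube indices (= of the centres) is at most `dist p q + 1`.
[cite: Dimock2013BalabanII, App. E proof of Lemma E.1 (2) (arXiv:1212.5562v2 TeX L6808–6811)] -/
theorem supDist_le_dist_add_one {x y : Pt d} {p q : RPt d} (hp : p ∈ cube x) (hq : q ∈ cube y) :
    (supDist x y : ℝ) ≤ dist p q + 1 := by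
  refine natCast_supDist_le (by positivity) fun i => ?_
  have hpi := (mem_cube.1 hp) i
  have hqi := (mem_cube.1 hq) i
  have hdi : |p i - q i| ≤ dist p q := by
    rw [← Real.dist_eq]; exact dist_le_pi_dist p q i
  rw [abs_le]
  constructor
  · have := neg_abs_le (p i - q i); linarith [hpi.1, hpi.2, hqi.1, hqi.2]
  · have := le_abs_self (p i - q i); linarith [hpi.1, hpi.2, hqi.1, hqi.2]

/-- A Steiner-admissible graph has a segment. [folklore] -/
theorem ne_nil_of_sAdmissible {Y : Finset (Pt d)} {T : List (Seg d)} (hT : SAdmissible Y T) : T ≠ [] := by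
  intro h
  have := hT.connected.nonempty
  rw [h, carrier_nil] at this
  exact Set.not_nonempty_empty this

/-- **LEMMA E.1 (1)–(2) ON THE CARRIER** — for a non-empty finite union of unit cubes `Y` and every connected
polygonal graph `T` meeting every cube of `Y` (pv22 `SAdmissible`; sup metric), the minimal centre-tree length
obeys `ℓ′(Y) ≤ 2·len T + (#Y − 1)`: subdivide `T` at one point per cube (Part 3), apply the Steiner ratio by
generations (`treeLen'_le_two_mul_wt`, = E.1 (1) [DIS73]) and pull back to the centres at cost `1` per edge
(`treeLen'_pullback_le`, = E.1 (2)). [cite: Dimock2013BalabanII, App. E Lemma E.1 (1)–(2) (arXiv:1212.5562v2 TeX L6792–6795, proofs L6804–6815)] -/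
theorem treeLen'_le_two_mul_len_add {Y : Finset (Pt d)} (hY : Y.Nonempty) {T : List (Seg d)}
    (hT : SAdmissible Y T) : treeLen' (phiZ 1) Y ≤ 2 * len T + ((Y.card : ℝ) - 1) := by
  -- one point per cube
  have hw : ∀ y ∈ Y, ∃ z, z ∈ carrier T ∧ z ∈ cube y := fun y hy => by
    obtain ⟨z, hz⟩ := hT.meets y hy; exact ⟨z, hz.1, hz.2⟩
  choose! w hwT hwc using hw
  set S := Y.image w with hS
  have hSsub : ∀ p ∈ S, p ∈ carrier T := fun p hp => by
    obtain ⟨y, hy, rfl⟩ := Finset.mem_image.1 hp; exact hwT y hy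
  obtain ⟨V, hSV, -, E, hE, hwt⟩ :=
    exists_subdivision hT.connected.isPreconnected (ne_nil_of_sAdmissible hT) hSsub
  have hSne : S.Nonempty := by obtain ⟨y, hy⟩ := hY; exact ⟨w y, Finset.mem_image_of_mem w hy⟩
  -- E.1 (1), graph form: ℓ′_dist(S) ≤ 2·wt E
  have h1 : treeLen' (δR (d := d)) S ≤ 2 * wt δR E :=
    treeLen'_le_two_mul_wt (d := fun p q : RPt d => dist p q) dist_comm dist_self (fun _ _ => dist_nonneg)
      dist_triangle hSV hSne hE
  -- E.1 (2): pull back to the cube indices (centres) at cost 1 per edge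
  have h2 : treeLen' (phiZ 1) Y ≤ treeLen' (δR (d := d)) S + 1 * ((Y.card : ℝ) - 1) := by
    refine treeLen'_pullback_le w dist_comm dist_self (fun _ _ => dist_nonneg)
      (fun e _ => phiZ_nonneg zero_le_one e) zero_le_one (fun y hy y' hy' _ => ?_) hY
    rw [phiZ_mk, one_mul]
    exact supDist_le_dist_add_one (hwc y hy) (hwc y' hy')
  linarith

/-- **`ℓ′(Y) ≤ 2ℓ̃(Y) + (#Y − 1)`** with the cell's Steiner length `ℓ̃ = steinerLen` (the infimum over all connected
polygonal graphs meeting every cube of `Y`): Lemma E.1 (1) + (2) combined, with `ℓ̃ ≤ ℓ` in place of `ℓ` and the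
print's `+|Y|` a fortiori. [cite: Dimock2013BalabanII, App. E Lemma E.1 (1)–(2) (arXiv:1212.5562v2 TeX L6792–6795)] -/
theorem treeLen'_le_two_mul_steinerLen_add {Y : Finset (Pt d)} (hY : Y.Nonempty) :
    treeLen' (phiZ 1) Y ≤ 2 * steinerLen Y + ((Y.card : ℝ) - 1) := by
  have h : (treeLen' (phiZ 1) Y - ((Y.card : ℝ) - 1)) / 2 ≤ steinerLen Y := by
    refine le_steinerLen (exists_sAdmissible hY) fun T hT => ?_
    have := treeLen'_le_two_mul_len_add hY hT
    rw [div_le_iff₀ (by norm_num : (0 : ℝ) < 2)]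
    linarith
  rw [div_le_iff₀ (by norm_num : (0 : ℝ) < 2)] at h
  linarith

end Carrier

/-! ## Part 5. Lemma E.2 for the Steiner length -/

section Steiner

variable {d : ℕ}

/-- Changing the prefactor: `ℓ′_{a} = a·ℓ′_{1}` for `a > 0`. [folklore] -/
theorem treeLen'_phiZ {a : ℝ} (ha : 0 < a) (Y : Finset (Pt d)) :
    treeLen' (phiZ a) Y = a * treeLen' (phiZ 1) Y := by
  have hfun : (phiZ a : Sym2 (Pt d) → ℝ) = fun e => a * phiZ 1 e := by
    funext e
    induction e using Sym2.ind with
    | h x y => rw [phiZ_mk, phiZ_mk, one_mul]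
  rw [hfun, treeLen'_smul ha]

/-- The threshold forces `a′ > 0`. [folklore] -/
theorem pos_of_threshold {a : ℝ} (ha : (3 : ℝ) ^ d * exp (-a) ≤ 1 / 8) : 0 < a := by
  by_contra h
  have h1 : (1 : ℝ) ≤ exp (-a) := Real.one_le_exp (by linarith)
  have h3 : (1 : ℝ) ≤ (3 : ℝ) ^ d := one_le_pow₀ (by norm_num)
  nlinarith

/-- `ℓ̃(Y) ≥ (ℓ′(Y) − (2^d − 1))/(2 + 2^{d+2})` — E.1 (1)+(2) on the carrier combined with E.1 (3) in pv22's form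
`#Y ≤ 2^d(4ℓ̃(Y) + 1)` (`TreeLength.card_le_steinerLen`). [cite: Dimock2013BalabanII, App. E Lemma E.1 (arXiv:1212.5562v2 TeX L6790–6798)] -/
theorem treeLen'_le_affine_steinerLen {Y : Finset (Pt d)} (hY : Y.Nonempty) :
    treeLen' (phiZ 1) Y ≤ (2 + 2 ^ (d + 2)) * steinerLen Y + (2 ^ d - 1) := by
  have h1 := treeLen'_le_two_mul_steinerLen_add hY
  have h2 := card_le_steinerLen hY
  have : (2 : ℝ) ^ (d + 2) = 2 ^ d * 4 := by rw [pow_add]; norm_num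
  rw [this]
  nlinarith

/-- **LEMMA E.2 FOR THE STEINER LENGTH** — [Dimock2013BalabanII] App. E Lemma E.2 (2), verbatim: *"There are
constants a, b = 𝒪(1) such that Σ_{Y : Y ⊃ □₀} exp(−aℓ_M(Y)) ≤ b"* — PROVED on the cell's carrier for the STEINER
length `ℓ̃ ≤ ℓ` (hence a fortiori for `ℓ` and `ℓ′`), constants explicit: if `3^d·exp(−a/(2 + 2^{d+2})) ≤ 1/8` then
for every cube `x₀` and every finite family `𝒴` of finite unions of unit cubes containing `x₀`,
`Σ_{Y∈𝒴} exp(−a·ℓ̃(Y)) ≤ 2·exp((a/(2 + 2^{d+2}))·(2^d − 1))`.  Chain: E.1 on the carrier + E.1 (3) ⇒ `ℓ′ ≤ (2 +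
2^{d+2})ℓ̃ + (2^d − 1)`, then E.2 (1) (`kumquat_one`) at `a′ = a/(2 + 2^{d+2})`.
[cite: Dimock2013BalabanII, App. E Lemma E.2 (2) (arXiv:1212.5562v2 TeX L6840–6845, proof L6896–6908)] -/
theorem kumquat_steiner {a : ℝ} (ha : (3 : ℝ) ^ d * exp (-(a / (2 + 2 ^ (d + 2)))) ≤ 1 / 8) (x₀ : Pt d)
    (𝒴 : Finset (Finset (Pt d))) (h𝒴 : ∀ Y ∈ 𝒴, x₀ ∈ Y) :
    ∑ Y ∈ 𝒴, exp (-(a * steinerLen Y)) ≤ 2 * exp (a / (2 + 2 ^ (d + 2)) * (2 ^ d - 1)) := by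
  set A : ℝ := 2 + 2 ^ (d + 2) with hA
  set a' : ℝ := a / A with ha'
  have hApos : 0 < A := by positivity
  have ha'pos : 0 < a' := pos_of_threshold ha
  have haa : a = a' * A := by rw [ha', div_mul_cancel₀ a hApos.ne']
  have hper : ∀ Y ∈ 𝒴, exp (-(a * steinerLen Y)) ≤ exp (a' * (2 ^ d - 1)) * exp (-treeLen' (phiZ a') Y) := by
    intro Y hY
    have hYne : Y.Nonempty := ⟨x₀, h𝒴 Y hY⟩
    have h1 := treeLen'_le_affine_steinerLen hYne
    rw [← Real.exp_add, treeLen'_phiZ ha'pos]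
    refine Real.exp_le_exp.2 ?_
    rw [haa]
    have := mul_le_mul_of_nonneg_left h1 ha'pos.le
    nlinarith
  calc ∑ Y ∈ 𝒴, exp (-(a * steinerLen Y)) ≤ ∑ Y ∈ 𝒴, exp (a' * (2 ^ d - 1)) * exp (-treeLen' (phiZ a') Y) :=
        Finset.sum_le_sum hper
    _ = exp (a' * (2 ^ d - 1)) * ∑ Y ∈ 𝒴, exp (-treeLen' (phiZ a') Y) := by rw [Finset.mul_sum]
    _ ≤ exp (a' * (2 ^ d - 1)) * 2 := mul_le_mul_of_nonneg_left (kumquat_one ha x₀ 𝒴 h𝒴) (exp_pos _).le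
    _ = 2 * exp (a / (2 + 2 ^ (d + 2)) * (2 ^ d - 1)) := by rw [mul_comm]

end Steiner

end Literature.MathematicalPhysics.QuantumFieldTheory.Dimock2011to13.SteinerLengthSums
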